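import Literature.Topology.FourManifolds.IsotopyExtensionSupportIcc
import Literature.Topology.FourManifolds.DiffeotopyProofs
import Literature.Topology.FourManifolds.ClosedBallProofs
import HarnessLib

/-!
# Isotopies of finitely many disjoint compact submanifolds are covered by one diffeotopy

Topic `Literature/Topology/FourManifolds`.  The Isotopy Extension Theorem of the tree
(`exists_ambientIsotopy_comp_eq`, `IsotopyExtension*.lean`; Thom, Palais, Cerf; Kosinski,
*Differential Manifolds* (1993), II (5.2); Hirsch, *Differential Topology* (1976), Ch. 8 §1,
Thm. 1.3; Milnor, *h-cobordism* (1965), Thm. 5.8) covers a smooth isotopy of **one** compact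
manifold `M` in a closed manifold `N` by an ambient isotopy.  An isotopy of a *link* — finitely
many embeddings `kᵢ : M → N` moved simultaneously by isotopies `φᵢ` whose stages `t ∈ [0, 1]`
have pairwise disjoint images — is classically handled by the same theorem applied to the
disjoint union `⊔ᵢ M`.  This file obtains the statement **by induction on the components**
instead (Mathlib has no convenient smooth structure on `ι × M` for a finite discrete `ι`):

* `exists_diffeotopy_forall_comp_eq` — there is a diffeotopy `D` of `N`
  (`Literature.Topology.FourManifolds.Diffeotopy`: jointly smooth stages and inverse stages)
  with `D_t ∘ kᵢ = φᵢ(t)` for all `i` and all `t ∈ [0, 1]`.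

*Inductive step.* Given `D` covering the components `i ∈ s`, pull the isotopy of a new
component `j` back by `D`: `F_t = D_t⁻¹ ∘ φⱼ(t)` is a smooth isotopy of `kⱼ` whose stages
`t ∈ [0, 1]` avoid the compact set `⋃_{i ∈ s} kᵢ(M)` (because `D_t ∘ kᵢ = φᵢ(t)` is disjoint
from `φⱼ(t)`); the isotopy extension theorem *with support in the complement of that set*
(`exists_ambientIsotopy_comp_eq_of_subset_Icc`, `IsotopyExtensionSupportIcc.lean`) gives an
ambient isotopy `Θ` covering `F` and fixing the `kᵢ(M)`, `i ∈ s`, pointwise; every ambient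
isotopy is a diffeotopy (`AmbientIsotopy.exists_diffeotopy_toFun_eq_invFun_eq`,
`DiffeotopyProofs.lean`), and the stagewise composite `D_t ∘ Θ_t` (`Diffeotopy.trans`) covers
the components `i ∈ s ∪ {j}`.  Everything is proved; no named facts.  Used for the input AMB
(isotopies of links in `∂W`) of the isotopy invariance of handle attachment
(`Geometry/Symplectic/TwoHandleIsotopyReduction.lean`).

## References

* A. A. Kosinski, *Differential Manifolds* (1993), II (5.2). [Kosinski1993]
* M. W. Hirsch, *Differential Topology*, GTM 33 (1976), Ch. 8 §1, Thms. 1.3–1.4. [HirschDT1976]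
-/

open scoped Manifold ContDiff Topology
open Set Function Filter

noncomputable section

namespace Literature.Topology.FourManifolds

section Link

variable {EM : Type*} [NormedAddCommGroup EM] [NormedSpace ℝ EM] [CompleteSpace EM]
  {HM : Type*} [TopologicalSpace HM] {I : ModelWithCorners ℝ EM HM} [I.Boundaryless]
  {M : Type*} [TopologicalSpace M] [ChartedSpace HM M] [IsManifold I ∞ M] [CompactSpace M]
  {EN : Type*} [NormedAddCommGroup EN] [NormedSpace ℝ EN] [FiniteDimensional ℝ EN]
  {HN : Type*} [TopologicalSpace HN] {J : ModelWithCorners ℝ EN HN} [J.Boundaryless]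
  {N : Type*} [TopologicalSpace N] [ChartedSpace HN N] [IsManifold J ∞ N] [T2Space N]
  [CompactSpace N]

omit [CompleteSpace EM] [I.Boundaryless] [IsManifold I ∞ M] [CompactSpace M] [FiniteDimensional ℝ EN]
  [J.Boundaryless] [T2Space N] [CompactSpace N] in
/-- **The pull-back of an isotopy by a diffeotopy**: `t ↦ D_t⁻¹ ∘ φ(t)`, a smooth isotopy from
`k = φ(0)` to `D₁⁻¹ ∘ φ(1)` (joint smoothness of the inverse stages of a diffeotopy; each stage
an embedding composed with a diffeomorphism). [folklore] -/
def SmoothIsotopy.pullback {k k' : M → N} (φ : SmoothIsotopy I J k k') (D : Diffeotopy J N) :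
    SmoothIsotopy I J k (D.invFun 1 ∘ k') where
  toFun t := D.invFun t ∘ φ.toFun t
  contMDiff := D.contMDiff_uncurry_invFun.comp (contMDiff_fst.prodMk φ.contMDiff)
  isSmoothEmbedding t := (φ.isSmoothEmbedding t).diffeomorph_comp (D.stage t).symm
  map_zero := by
    funext u
    show D.invFun 0 (φ.toFun 0 u) = k u
    rw [D.invFun_zero, φ.map_zero]; rfl
  map_one := by
    funext u
    show D.invFun 1 (φ.toFun 1 u) = D.invFun 1 (k' u)
    rw [φ.map_one]

omit [CompleteSpace EM] [I.Boundaryless] [IsManifold I ∞ M] [CompactSpace M] [FiniteDimensional ℝ EN]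
  [J.Boundaryless] [T2Space N] [CompactSpace N] in
/-- Stages of the pull-back. [folklore] -/
@[simp] theorem SmoothIsotopy.pullback_toFun {k k' : M → N} (φ : SmoothIsotopy I J k k')
    (D : Diffeotopy J N) (t : ℝ) : (φ.pullback D).toFun t = D.invFun t ∘ φ.toFun t := rfl

/-- **Isotopies of finitely many disjoint compact submanifolds are covered by one diffeotopy**
(the isotopy extension theorem for links; Kosinski 1993, II (5.2), Hirsch 1976, Ch. 8 §1
Thm. 1.3, applied inductively with support control).  Let `kᵢ : M → N`, `i ∈ ι` finite, be
embeddings of a compact `M` (complete boundaryless model) into a compact Hausdorff `N`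
(finite-dimensional boundaryless model), moved by smooth isotopies `φᵢ` from `kᵢ` to `kᵢ'`
whose stages `t ∈ [0, 1]` have pairwise disjoint images.  Then there is a diffeotopy `D` of
`N` with `D_t ∘ kᵢ = φᵢ(t)` for all `i` and all `t ∈ [0, 1]`.
[cite: Kosinski1993, II (5.2)] -/
theorem exists_diffeotopy_forall_comp_eq {ι : Type*} [Finite ι] {k k' : ι → M → N}
    (φ : ∀ i, SmoothIsotopy I J (k i) (k' i))
    (hdisj : ∀ t ∈ Icc (0 : ℝ) 1, Pairwise fun i j =>
      Disjoint (range ((φ i).toFun t)) (range ((φ j).toFun t))) :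
    ∃ D : Diffeotopy J N, ∀ i, ∀ t ∈ Icc (0 : ℝ) 1, D.toFun t ∘ k i = (φ i).toFun t := by
  classical
  haveI := Fintype.ofFinite ι
  suffices h : ∀ s : Finset ι, ∃ D : Diffeotopy J N, ∀ i ∈ s, ∀ t ∈ Icc (0 : ℝ) 1,
      D.toFun t ∘ k i = (φ i).toFun t by
    obtain ⟨D, hD⟩ := h Finset.univ
    exact ⟨D, fun i => hD i (Finset.mem_univ i)⟩
  intro s
  induction s using Finset.induction_on with
  | empty => exact ⟨Diffeotopy.refl J N, fun i hi => absurd hi (Finset.notMem_empty i)⟩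
  | insert j s hj ih =>
    obtain ⟨D, hD⟩ := ih
    -- the compact set already handled and its open complement
    set C : Set N := ⋃ i ∈ s, range (k i) with hC
    have hCc : IsClosed C := by
      refine Set.Finite.isClosed_biUnion s.finite_toSet fun i _ => ?_
      have hk : Continuous (k i) := by
        have := ((φ i).isSmoothEmbedding 0).contMDiff.continuous
        rw [(φ i).map_zero] at this; exact this
      exact (isCompact_range hk).isClosed
    have hO : IsOpen Cᶜ := hCc.isOpen_compl
    -- the pulled-back isotopy of the new component avoids `C` on `[0, 1]`
    set F := (φ j).pullback D with hF
    have hFO : ∀ t ∈ Icc (0 : ℝ) 1, ∀ x, F.toFun t x ∈ Cᶜ := by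
      intro t ht x hx
      have hx' : D.invFun t ((φ j).toFun t x) ∈ C := hx
      rw [hC, mem_iUnion₂] at hx'
      obtain ⟨i, hi, u, hu⟩ := hx'
      have hij : i ≠ j := fun h => hj (h ▸ hi)
      have h1 : D.toFun t (k i u) = (φ j).toFun t x := by
        rw [hu, D.toFun_invFun]
      have h2 : D.toFun t (k i u) = (φ i).toFun t u := congrFun (hD i hi t ht) u
      exact Set.disjoint_left.1 (hdisj t ht hij) (mem_range_self u) ⟨x, h1.symm.trans h2⟩
    -- ambient isotopy covering `F`, fixing `C` pointwise; as a diffeotopy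
    obtain ⟨Ψ, hΨ, hfix⟩ := exists_ambientIsotopy_comp_eq_of_subset_Icc F hO hFO
    obtain ⟨Θ, hΘ, -⟩ := Ψ.exists_diffeotopy_toFun_eq_invFun_eq
    refine ⟨Θ.trans D, fun i hi t ht => funext fun u => ?_⟩
    rw [Diffeotopy.trans_toFun]
    show D.toFun t (Θ.toFun t (k i u)) = (φ i).toFun t u
    rw [hΘ]
    rcases Finset.mem_insert.1 hi with rfl | hi'
    · -- the new component
      have h1 : Ψ.toFun t (k i u) = F.toFun t u := congrFun (hΨ t ht) u
      rw [h1]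
      show D.toFun t (D.invFun t ((φ i).toFun t u)) = (φ i).toFun t u
      rw [D.toFun_invFun]
    · -- an old component: fixed by `Ψ_t`, then moved by `D_t`
      have hmem : k i u ∉ Cᶜ := fun h => h (by rw [hC]; exact mem_iUnion₂.2 ⟨i, hi', mem_range_self u⟩)
      rw [hfix t (k i u) hmem]
      exact congrFun (hD i hi' t ht) u

end Link

end Literature.Topology.FourManifolds

end
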